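import Mathlib.Analysis.SpecialFunctions.Gaussian.PoissonSummation
import Mathlib.NumberTheory.ModularForms.JacobiTheta.TwoVariable
import Mathlib.Analysis.SpecialFunctions.Integrals.Basic
import Mathlib.Analysis.SpecificLimits.Normed
import Mathlib.GroupTheory.SpecificGroups.Cyclic
import Mathlib.Data.ZMod.QuotientGroup
import Literature.Computability.Cryptography.LWENoise
import HarnessLib

/-!
# Mass of the discretised Gaussian `Ψ̄_α` at zero and on subgroups of `ℤ_q`

Sibling analysis file of `Literature.Computability.Cryptography.LWENoise` (which defines Regev's
discretised Gaussian `discretizedGaussian q α = Ψ̄_α`, the law of `⌊q X⌉ mod q`,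
`X ∼ N(0, α²/(2π))`). It supplies the quantitative non-uniformity of `Ψ̄_α` used by the easy
direction "search ⇒ decision" of Regev's search/decision equivalence for LWE
(`Literature.Computability.Cryptography.regev_search_to_decision`; Regev 2009, §1, p. 4: "being
able to distinguish [LWE samples] from [uniform ones] is equivalent to solving LWE", and "a value
chosen from `Ψ̄_α` is `0` with probability roughly `1/(αp)`"):

* `discretizedGaussian_zero_toReal_ge` — for every modulus `p ≥ 2` and width `β > 0`,
  `Ψ̄_β(0) ≥ 1/p + (4/(3π)) · sin(π/p) · e^{-πβ²}`;
* `discretizedGaussian_zero_toReal_ge_inv` — `Ψ̄_β(0) ≥ 1/p` for every `p ≥ 1`;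
* `discretizedGaussian_sum_addSubgroup_ge` — for every subgroup `H ≤ ℤ_q`, `Ψ̄_β(H) ≥ |H|/q`.

## Proof (theta-function route; folklore, fully proved here)

`Ψ̄_β(0)` is the Gaussian mass of `⋃ₖ [k - 1/(2p), k + 1/(2p))`, i.e. `∫_{-1/(2p)}^{1/(2p)} F_β`
with `F_β(t) = ∑ₖ β⁻¹ e^{-π (t+k)²/β²}`. Jacobi's transformation formula (Poisson summation for the
Gaussian; Mathlib `Complex.tsum_exp_neg_quadratic`) gives `F_β(t) = ∑_{j ∈ ℤ} e^{-πβ²j²} cos(2πjt)`,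
so integrating termwise `Ψ̄_β(0) = 1/p + 2 ∑_{j ≥ 1} e^{-πβ²j²} sin(πj/p)/(πj)`. Grouping
`j = ℓp + r`, the terms with `r = 0` vanish and for `1 ≤ r < p` the inner series is alternating
with antitone terms, hence `≥ 0`; keeping `r = 1` gives the bound (Leibniz:
`Antitone.alternating_series_le_tendsto`). The subgroup statement follows by the classification
`H = d ℤ_q`, `d ∣ q`, `|H| = q/d` and the scaling identity `Ψ̄_{q,β}(dℤ_q) = Ψ̄_{d, βq/d}(0)`.

## References

* O. Regev, *On lattices, learning with errors, random linear codes, and cryptography*, J. ACM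
  56 (2009), §1 (p. 4 of arXiv:2401.03703), §2 (definitions of `Ψ_α`, `Ψ̄_α`).
* E. M. Stein, R. Shakarchi, *Fourier Analysis*, Princeton 2003, Ch. 5, Thm. 3.1 and §5.3.3
  (Poisson summation, theta function); Mathlib `Complex.tsum_exp_neg_quadratic`.
-/

noncomputable section

open MeasureTheory ProbabilityTheory Filter Topology
open scoped ENNReal NNReal

namespace Literature.Computability.Cryptography

namespace LWE

/-! ### Gaussian sums over `ℤ` -/

section GaussSums

/-- A Gaussian with a linear term is summable over `ℤ` (as the terms of a Jacobi theta series).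
[Stein–Shakarchi 2003, Ch. 5 §3] [folklore] -/
theorem summable_exp_neg_mul_sq_add_mul {a : ℝ} (ha : 0 < a) (b : ℝ) :
    Summable fun n : ℤ => Real.exp (-a * (n : ℝ) ^ 2 + b * n) := by
  set z : ℂ := -Complex.I * ((b / (2 * Real.pi) : ℝ) : ℂ) with hz
  set τ : ℂ := Complex.I * ((a / Real.pi : ℝ) : ℂ) with hτ
  have hτim : 0 < τ.im := by
    rw [hτ, Complex.mul_im, Complex.I_re, Complex.I_im, Complex.ofReal_re, Complex.ofReal_im]
    simp only [zero_mul, one_mul, zero_add]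
    positivity
  have hs := (summable_jacobiTheta₂_term_iff z τ).2 hτim
  have heq : (fun n : ℤ => jacobiTheta₂_term n z τ)
      = fun n : ℤ => ((Real.exp (-a * (n : ℝ) ^ 2 + b * n) : ℝ) : ℂ) := by
    funext n
    rw [jacobiTheta₂_term, Complex.ofReal_exp]
    congr 1
    rw [hz, hτ]
    push_cast
    have e1 : 2 * (Real.pi : ℂ) * Complex.I * n * (-Complex.I * ((b : ℂ) / (2 * Real.pi)))
        = -(Complex.I * Complex.I) * b * n := by field_simp
    have e2 : (Real.pi : ℂ) * Complex.I * (n : ℂ) ^ 2 * (Complex.I * ((a : ℂ) / Real.pi))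
        = (Complex.I * Complex.I) * a * n ^ 2 := by field_simp
    rw [e1, e2, Complex.I_mul_I]
    ring
  rw [heq] at hs
  exact Complex.summable_ofReal.1 hs

/-- A Gaussian is summable over `ℤ`. (Twin, up to the name, of
`Literature.NumberTheory.Automorphic.summable_exp_neg_mul_int_sq` in
`NumberTheory/Automorphic/ModularEisensteinContinuation.lean`; that file imports all of Mathlib and
the Eisenstein-series development and is not importable here at reasonable cost — both copies are
owed a relocation to a shared analysis home.) [folklore] -/
theorem summable_exp_neg_mul_sq {a : ℝ} (ha : 0 < a) :
    Summable fun n : ℤ => Real.exp (-a * (n : ℝ) ^ 2) := by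
  simpa using summable_exp_neg_mul_sq_add_mul ha 0

/-- The Gaussian kernel `φ_β(x) = β⁻¹ e^{-π x²/β²}` (Regev's `ν_β` density, the density of
`N(0, β²/(2π))`). [Regev 2009, §2] [cite: Regev2009, §2] -/
def gaussKernel (β x : ℝ) : ℝ := β⁻¹ * Real.exp (-Real.pi * x ^ 2 / β ^ 2)

/-- `φ_β` is the density `gaussianPDFReal 0 (β²/(2π))`. [Regev 2009, §2] [folklore] -/
theorem gaussianPDFReal_eq_gaussKernel {β : ℝ} (hβ : 0 < β) (x : ℝ) :
    gaussianPDFReal 0 (Real.toNNReal (β ^ 2 / (2 * Real.pi))) x = gaussKernel β x := by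
  rw [gaussianPDFReal_def, gaussKernel]
  have hv : ((Real.toNNReal (β ^ 2 / (2 * Real.pi)) : ℝ≥0) : ℝ) = β ^ 2 / (2 * Real.pi) :=
    Real.coe_toNNReal _ (by positivity)
  simp only [hv, sub_zero]
  have h1 : Real.sqrt (2 * Real.pi * (β ^ 2 / (2 * Real.pi))) = β := by
    rw [show 2 * Real.pi * (β ^ 2 / (2 * Real.pi)) = β ^ 2 by field_simp]
    exact Real.sqrt_sq hβ.le
  rw [h1]
  congr 2
  field_simp

/-- `φ_β ≥ 0`. [folklore] -/
theorem gaussKernel_nonneg {β : ℝ} (hβ : 0 < β) (x : ℝ) : 0 ≤ gaussKernel β x := by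
  unfold gaussKernel; positivity

/-- `k ↦ φ_β(t + k)` is summable over `ℤ`. [folklore] -/
theorem summable_gaussKernel_add_int {β : ℝ} (hβ : 0 < β) (t : ℝ) :
    Summable fun k : ℤ => gaussKernel β (t + k) := by
  have h := (summable_exp_neg_mul_sq_add_mul (a := Real.pi / β ^ 2) (by positivity)
    (-(2 * Real.pi * t / β ^ 2))).mul_left (β⁻¹ * Real.exp (-Real.pi * t ^ 2 / β ^ 2))
  refine h.congr fun k => ?_
  simp only [gaussKernel]
  rw [mul_assoc, ← Real.exp_add]
  congr 2
  field_simp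
  ring

/-- **Jacobi's transformation formula, real form**: for `β > 0`,
`∑ₖ β⁻¹ e^{-π(t+k)²/β²} = ∑ⱼ e^{-πβ²j²} cos(2πjt)`. [Stein–Shakarchi 2003, Ch. 5, Thm. 3.1 /
§5.3.3; Mathlib `Complex.tsum_exp_neg_quadratic`] [folklore] -/
theorem tsum_gaussKernel_add_int_eq {β : ℝ} (hβ : 0 < β) (t : ℝ) :
    ∑' k : ℤ, gaussKernel β (t + k) =
      ∑' j : ℤ, Real.exp (-Real.pi * β ^ 2 * (j : ℝ) ^ 2) * Real.cos (2 * Real.pi * j * t) := by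
  have ha : 0 < (((β ^ 2 : ℝ)) : ℂ).re := by simp only [Complex.ofReal_re]; positivity
  have key := Complex.tsum_exp_neg_quadratic ha (Complex.I * (t : ℂ))
  -- the left-hand side of `key`
  have hsumL : Summable fun n : ℤ =>
      Complex.exp (-Real.pi * ((β ^ 2 : ℝ) : ℂ) * (n : ℂ) ^ 2 + 2 * Real.pi * (Complex.I * t) * n) := by
    have hs := (summable_jacobiTheta₂_term_iff (t : ℂ) (Complex.I * ((β ^ 2 : ℝ) : ℂ))).2 (by
      rw [Complex.mul_im, Complex.I_re, Complex.I_im, Complex.ofReal_re, Complex.ofReal_im]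
      simp only [zero_mul, one_mul, zero_add]; positivity)
    refine hs.congr fun n => ?_
    rw [jacobiTheta₂_term]
    congr 1
    have hI : Complex.I * Complex.I = -1 := Complex.I_mul_I
    linear_combination (↑Real.pi * ((β ^ 2 : ℝ) : ℂ) * (n : ℂ) ^ 2) * hI
  have hL : (∑' n : ℤ, Complex.exp (-Real.pi * ((β ^ 2 : ℝ) : ℂ) * (n : ℂ) ^ 2
      + 2 * Real.pi * (Complex.I * t) * n)).re
      = ∑' j : ℤ, Real.exp (-Real.pi * β ^ 2 * (j : ℝ) ^ 2) * Real.cos (2 * Real.pi * j * t) := by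
    rw [Complex.re_tsum hsumL]
    refine tsum_congr fun n => ?_
    have hz : (-Real.pi * ((β ^ 2 : ℝ) : ℂ) * (n : ℂ) ^ 2 + 2 * Real.pi * (Complex.I * t) * n)
        = ((-Real.pi * β ^ 2 * (n : ℝ) ^ 2 : ℝ) : ℂ) + ((2 * Real.pi * n * t : ℝ) : ℂ) * Complex.I := by
      push_cast; ring
    rw [hz, Complex.exp_re]
    simp only [Complex.add_re, Complex.add_im, Complex.ofReal_re, Complex.ofReal_im, Complex.mul_re,
      Complex.mul_im, Complex.I_re, Complex.I_im, mul_zero, mul_one, zero_add, add_zero, sub_zero]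
  -- the right-hand side of `key`
  have hcpow : (((β ^ 2 : ℝ)) : ℂ) ^ (1 / 2 : ℂ) = (β : ℂ) := by
    rw [show (1 / 2 : ℂ) = ((1 / 2 : ℝ) : ℂ) by push_cast; ring,
      ← Complex.ofReal_cpow (by positivity), ← Real.sqrt_eq_rpow, Real.sqrt_sq hβ.le]
  have hterm : ∀ n : ℤ, Complex.exp (-Real.pi / ((β ^ 2 : ℝ) : ℂ) * ((n : ℂ) + Complex.I * (Complex.I * t)) ^ 2)
      = ((Real.exp (-Real.pi * ((n : ℝ) - t) ^ 2 / β ^ 2) : ℝ) : ℂ) := by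
    intro n
    rw [Complex.ofReal_exp]
    congr 1
    rw [← mul_assoc, Complex.I_mul_I, neg_one_mul]
    push_cast
    ring
  have hR : (1 / (((β ^ 2 : ℝ)) : ℂ) ^ (1 / 2 : ℂ) *
      ∑' n : ℤ, Complex.exp (-Real.pi / ((β ^ 2 : ℝ) : ℂ) * ((n : ℂ) + Complex.I * (Complex.I * t)) ^ 2)).re
      = ∑' k : ℤ, gaussKernel β (t + k) := by
    rw [hcpow, tsum_congr hterm, ← Complex.ofReal_tsum, one_div,
      show ((β : ℂ))⁻¹ = ((β⁻¹ : ℝ) : ℂ) by push_cast; rfl, ← Complex.ofReal_mul, Complex.ofReal_re,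
      ← tsum_mul_left]
    rw [← Equiv.tsum_eq (Equiv.neg ℤ)]
    refine tsum_congr fun k => ?_
    simp only [Equiv.neg_apply, Int.cast_neg, gaussKernel]
    congr 2
    ring
  rw [← hR, ← key, hL]

/-- The Fourier side `G_β(t) = ∑ⱼ e^{-πβ²j²} cos(2πjt)` is continuous (Weierstrass M-test).
[folklore] -/
theorem continuous_tsum_exp_mul_cos {β : ℝ} (hβ : 0 < β) :
    Continuous fun t : ℝ =>
      ∑' j : ℤ, Real.exp (-Real.pi * β ^ 2 * (j : ℝ) ^ 2) * Real.cos (2 * Real.pi * j * t) := by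
  refine continuous_tsum (fun j => by fun_prop)
    (summable_exp_neg_mul_sq (a := Real.pi * β ^ 2) (by positivity)) fun j t => ?_
  rw [norm_mul, Real.norm_eq_abs, Real.norm_eq_abs, abs_of_pos (Real.exp_pos _), neg_mul]
  exact mul_le_of_le_one_right (Real.exp_pos _).le (Real.abs_cos_le_one _)

/-- `G_β ≥ 0` (it is a sum of Gaussians). [folklore] -/
theorem tsum_exp_mul_cos_nonneg {β : ℝ} (hβ : 0 < β) (t : ℝ) :
    0 ≤ ∑' j : ℤ, Real.exp (-Real.pi * β ^ 2 * (j : ℝ) ^ 2) * Real.cos (2 * Real.pi * j * t) := by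
  rw [← tsum_gaussKernel_add_int_eq hβ]
  exact tsum_nonneg fun k => gaussKernel_nonneg hβ _

end GaussSums

/-! ### The zero cell of the discretisation -/

section ZeroCell

variable (p : ℕ) [NeZero p]

/-- `⌊p x⌉ ≡ 0 (mod p)` iff `x` is within `1/(2p)` of an integer (half-open cells, Lean's
`round x = ⌊x + 1/2⌋`). [Regev 2009, §2 (discretisation)] [folklore] -/
theorem discretize_preimage_zero :
    discretize p ⁻¹' {0} = ⋃ k : ℤ, Set.Ico ((k : ℝ) - 1 / (2 * p)) (k + 1 / (2 * p)) := by
  have hp : (0 : ℝ) < p := by exact_mod_cast Nat.pos_of_ne_zero (NeZero.ne p)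
  ext x
  simp only [Set.mem_preimage, Set.mem_singleton_iff, Set.mem_iUnion, Set.mem_Ico, discretize]
  rw [ZMod.intCast_zmod_eq_zero_iff_dvd]
  have key : ∀ k : ℤ, ((p : ℝ) * k ≤ p * x + 1 / 2 ∧ (p : ℝ) * x + 1 / 2 < p * k + 1) ↔
      ((k : ℝ) - 1 / (2 * p) ≤ x ∧ x < k + 1 / (2 * p)) := by
    intro k
    have e : (p : ℝ) * (1 / (2 * p)) = 1 / 2 := by field_simp
    constructor
    · rintro ⟨h1, h2⟩
      constructor
      · refine le_of_mul_le_mul_left ?_ hp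
        rw [mul_sub, e]; linarith
      · refine lt_of_mul_lt_mul_left ?_ hp.le
        rw [mul_add, e]; linarith
    · rintro ⟨h1, h2⟩
      have h1' := mul_le_mul_of_nonneg_left h1 hp.le
      have h2' := mul_lt_mul_of_pos_left h2 hp
      rw [mul_sub, e] at h1'
      rw [mul_add, e] at h2'
      constructor <;> linarith
  constructor
  · rintro ⟨k, hk⟩
    rw [round_eq, Int.floor_eq_iff] at hk
    push_cast at hk
    exact ⟨k, (key k).1 hk⟩
  · rintro ⟨k, hk⟩
    refine ⟨k, ?_⟩
    rw [round_eq, Int.floor_eq_iff]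
    push_cast
    exact (key k).2 hk

/-- The zero cells are pairwise disjoint. [folklore] -/
theorem pairwise_disjoint_zeroCells :
    Pairwise (Function.onFun Disjoint
      fun k : ℤ => Set.Ico ((k : ℝ) - 1 / (2 * p)) (k + 1 / (2 * p))) := by
  have hp1 : (1 : ℝ) ≤ p := by exact_mod_cast Nat.one_le_iff_ne_zero.2 (NeZero.ne p)
  have hh : 1 / (2 * (p : ℝ)) ≤ 1 / 2 := one_div_le_one_div_of_le (by norm_num) (by linarith)
  intro k k' hne
  rw [Function.onFun, Set.disjoint_left]
  rintro x ⟨h1, h2⟩ ⟨h3, h4⟩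
  have e1 : (k : ℝ) < k' + 1 := by linarith
  have e2 : (k' : ℝ) < k + 1 := by linarith
  have e1' : k < k' + 1 := by exact_mod_cast e1
  have e2' : k' < k + 1 := by exact_mod_cast e2
  exact hne (le_antisymm (Int.lt_add_one_iff.1 e1') (Int.lt_add_one_iff.1 e2'))

/-- Translating a set integral over a cell back to the cell at `0`. [folklore] -/
theorem setLIntegral_Ico_add_right (f : ℝ → ℝ≥0∞) (a b c : ℝ) :
    ∫⁻ x in Set.Ico (a + c) (b + c), f x = ∫⁻ t in Set.Ico a b, f (t + c) := by
  rw [← lintegral_indicator measurableSet_Ico, ← lintegral_indicator measurableSet_Ico,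
    ← lintegral_add_right_eq_self (fun x => (Set.Ico (a + c) (b + c)).indicator f x) c]
  congr 1
  funext t
  by_cases ht : t ∈ Set.Ico a b
  · have ht' : t + c ∈ Set.Ico (a + c) (b + c) := ⟨by linarith [ht.1], by linarith [ht.2]⟩
    rw [Set.indicator_of_mem ht', Set.indicator_of_mem ht]
  · have ht' : t + c ∉ Set.Ico (a + c) (b + c) := by
      rintro ⟨h1, h2⟩
      exact ht ⟨by linarith, by linarith⟩
    rw [Set.indicator_of_notMem ht', Set.indicator_of_notMem ht]

variable {p}

/-- **Mass at zero as an integral of the periodised Gaussian over the zero cell.**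
[Regev 2009, §2] [folklore] -/
theorem discretizedGaussian_zero_eq_lintegral {β : ℝ} (hβ : 0 < β) :
    discretizedGaussian p β 0 =
      ∫⁻ t in Set.Ico (-(1 / (2 * (p : ℝ)))) (1 / (2 * p)),
        ENNReal.ofReal (∑' k : ℤ, gaussKernel β (t + k)) := by
  have hv : Real.toNNReal (β ^ 2 / (2 * Real.pi)) ≠ 0 := by
    rw [ne_eq, Real.toNNReal_eq_zero, not_le]; positivity
  rw [discretizedGaussian_apply, discretize_preimage_zero,
    measure_iUnion (pairwise_disjoint_zeroCells p) (fun _ => measurableSet_Ico)]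
  simp_rw [gaussianReal_apply _ hv]
  have htr : ∀ k : ℤ, ∫⁻ x in Set.Ico ((k : ℝ) - 1 / (2 * p)) (k + 1 / (2 * p)),
      gaussianPDF 0 (Real.toNNReal (β ^ 2 / (2 * Real.pi))) x
      = ∫⁻ t in Set.Ico (-(1 / (2 * (p : ℝ)))) (1 / (2 * p)),
        gaussianPDF 0 (Real.toNNReal (β ^ 2 / (2 * Real.pi))) (t + k) := by
    intro k
    rw [← setLIntegral_Ico_add_right, sub_eq_neg_add, add_comm (k : ℝ) (1 / (2 * p))]
  simp_rw [htr]
  rw [← lintegral_tsum (f := fun (k : ℤ) (t : ℝ) =>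
    gaussianPDF 0 (Real.toNNReal (β ^ 2 / (2 * Real.pi))) (t + k))
    (fun k => ((measurable_gaussianPDF _ _).comp (measurable_id.add_const _)).aemeasurable)]
  refine setLIntegral_congr_fun measurableSet_Ico fun t _ => ?_
  simp only [gaussianPDF]
  rw [← ENNReal.ofReal_tsum_of_nonneg (fun k => gaussianPDFReal_nonneg _ _ _)]
  · congr 1
    exact tsum_congr fun k => gaussianPDFReal_eq_gaussKernel hβ _
  · simp_rw [gaussianPDFReal_eq_gaussKernel hβ]
    exact summable_gaussKernel_add_int hβ t

/-- **Mass at zero as an interval integral of the Fourier side.** [folklore] -/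
theorem discretizedGaussian_zero_toReal_eq_integral {β : ℝ} (hβ : 0 < β) :
    (discretizedGaussian p β 0).toReal =
      ∫ t in (-(1 / (2 * (p : ℝ))))..(1 / (2 * p)),
        ∑' j : ℤ, Real.exp (-Real.pi * β ^ 2 * (j : ℝ) ^ 2) * Real.cos (2 * Real.pi * j * t) := by
  have hh : (0 : ℝ) ≤ 1 / (2 * p) := by positivity
  rw [discretizedGaussian_zero_eq_lintegral hβ]
  simp_rw [tsum_gaussKernel_add_int_eq hβ]
  rw [← ofReal_integral_eq_lintegral_ofReal, ENNReal.toReal_ofReal, intervalIntegral.integral_of_le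
    (by linarith), integral_Ico_eq_integral_Ioc]
  · rw [integral_Ico_eq_integral_Ioc, ← intervalIntegral.integral_of_le (by linarith)]
    exact intervalIntegral.integral_nonneg (by linarith) fun t _ => tsum_exp_mul_cos_nonneg hβ t
  · exact ((continuous_tsum_exp_mul_cos hβ).integrableOn_Icc).mono_set Set.Ico_subset_Icc_self
  · exact ae_of_all _ fun t => tsum_exp_mul_cos_nonneg hβ t

end ZeroCell

/-! ### Fourier coefficients of the zero cell and the series for the mass at zero -/

section Series

/-- `∫_{-h}^{h} cos(c t) dt = 2 sin(c h)/c` for `c ≠ 0`. [folklore] -/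
theorem integral_cos_mul_symm {c : ℝ} (hc : c ≠ 0) (h : ℝ) :
    ∫ t in (-h)..h, Real.cos (c * t) = 2 * Real.sin (c * h) / c := by
  rw [intervalIntegral.integral_comp_mul_left _ hc, integral_cos, mul_neg, Real.sin_neg]
  simp only [smul_eq_mul]
  field_simp
  ring

variable (p : ℕ)

/-- The summand of the series for `Ψ̄_β(0)`: `g_j = e^{-πβ²j²} sin(πj/p)/(πj)` (`g_0 = 0` by
Lean's `0/0 = 0`). [folklore] -/
def zeroMassTerm (β : ℝ) (j : ℕ) : ℝ :=
  Real.exp (-Real.pi * β ^ 2 * (j : ℝ) ^ 2) * (Real.sin (Real.pi * j / p) / (Real.pi * j))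

/-- `g_0 = 0`. [folklore] -/
@[simp] theorem zeroMassTerm_zero (β : ℝ) : zeroMassTerm p β 0 = 0 := by simp [zeroMassTerm]

/-- `|g_j| ≤ (e^{-πβ²})^j`. [folklore] -/
theorem abs_zeroMassTerm_le {β : ℝ} (hβ : 0 < β) (j : ℕ) :
    |zeroMassTerm p β j| ≤ Real.exp (-Real.pi * β ^ 2) ^ j := by
  rw [zeroMassTerm, abs_mul, abs_of_pos (Real.exp_pos _), ← Real.exp_nat_mul]
  have h1 : Real.exp (-Real.pi * β ^ 2 * (j : ℝ) ^ 2) ≤ Real.exp (j * (-Real.pi * β ^ 2)) := by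
    rw [Real.exp_le_exp]
    have hj : (j : ℝ) ≤ (j : ℝ) ^ 2 := by
      rcases Nat.eq_zero_or_pos j with rfl | hj
      · simp
      · have : (1 : ℝ) ≤ j := by exact_mod_cast hj
        nlinarith
    nlinarith [Real.pi_pos, sq_nonneg β, mul_pos Real.pi_pos (pow_pos hβ 2)]
  have h2 : |Real.sin (Real.pi * j / p) / (Real.pi * j)| ≤ 1 := by
    rcases Nat.eq_zero_or_pos j with rfl | hj
    · simp
    · rw [abs_div, abs_of_pos (by positivity : (0 : ℝ) < Real.pi * j)]
      refine div_le_one_of_le₀ ((Real.abs_sin_le_one _).trans ?_) (by positivity)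
      have : (1 : ℝ) ≤ j := by exact_mod_cast hj
      nlinarith [Real.two_le_pi]
  calc Real.exp (-Real.pi * β ^ 2 * (j : ℝ) ^ 2) * |Real.sin (Real.pi * j / p) / (Real.pi * j)|
      ≤ Real.exp (j * (-Real.pi * β ^ 2)) * 1 :=
        mul_le_mul h1 h2 (abs_nonneg _) (Real.exp_pos _).le
    _ = Real.exp (j * (-Real.pi * β ^ 2)) := mul_one _

/-- The series `∑ g_j` converges (absolutely). [folklore] -/
theorem summable_zeroMassTerm {β : ℝ} (hβ : 0 < β) : Summable (zeroMassTerm p β) := by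
  refine Summable.of_norm_bounded (g := fun j : ℕ => Real.exp (-Real.pi * β ^ 2) ^ j) ?_ ?_
  · exact summable_geometric_of_lt_one (Real.exp_pos _).le
      (Real.exp_lt_one_iff.2 (by nlinarith [Real.pi_pos, pow_pos hβ 2]))
  · intro j
    rw [Real.norm_eq_abs]
    exact abs_zeroMassTerm_le p hβ j

variable {p}

/-- **Series for the mass at zero**: `Ψ̄_β(0) = 1/p + 2 ∑_{j ≥ 1} e^{-πβ²j²} sin(πj/p)/(πj)`.
[Regev 2009, §1 ("`0` with probability roughly `1/(αp)`"), made exact; folklore] [folklore] -/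
theorem discretizedGaussian_zero_toReal_eq_tsum [NeZero p] {β : ℝ} (hβ : 0 < β) :
    (discretizedGaussian p β 0).toReal = 1 / p + 2 * ∑' j : ℕ, zeroMassTerm p β j := by
  have hp : (0 : ℝ) < p := by exact_mod_cast Nat.pos_of_ne_zero (NeZero.ne p)
  set h : ℝ := 1 / (2 * p) with hhdef
  have hh : 0 ≤ h := by positivity
  set e : ℤ → ℝ := fun j => Real.exp (-Real.pi * β ^ 2 * (j : ℝ) ^ 2) with hedef
  have he : Summable e := summable_exp_neg_mul_sq (a := Real.pi * β ^ 2) (by positivity) |>.congr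
    (fun j => by simp only [hedef, neg_mul])
  -- the coefficients
  set c : ℤ → ℝ := fun j => ∫ t in (-h)..h, Real.cos (2 * Real.pi * j * t) with hcdef
  have hc0 : c 0 = 1 / p := by
    simp only [hcdef, Int.cast_zero, mul_zero, zero_mul, Real.cos_zero]
    rw [intervalIntegral.integral_const, smul_eq_mul, mul_one, hhdef]
    field_simp
    ring
  have hcj : ∀ j : ℤ, j ≠ 0 → c j = Real.sin (Real.pi * j / p) / (Real.pi * j) := by
    intro j hj
    simp only [hcdef]
    rw [integral_cos_mul_symm (by positivity : (2 * Real.pi * j : ℝ) ≠ 0), hhdef]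
    rw [show 2 * Real.pi * (j : ℝ) * (1 / (2 * p)) = Real.pi * j / p by field_simp]
    field_simp
  have hcabs : ∀ j : ℤ, |c j| ≤ 2 * h := by
    intro j
    simp only [hcdef]
    have := intervalIntegral.norm_integral_le_of_norm_le_const (a := -h) (b := h) (C := 1)
      (f := fun t => Real.cos (2 * Real.pi * j * t)) (fun t _ => by
        rw [Real.norm_eq_abs]; exact Real.abs_cos_le_one _)
    rw [Real.norm_eq_abs] at this
    calc _ ≤ 1 * |h - -h| := this
      _ = 2 * h := by rw [sub_neg_eq_add, abs_of_nonneg (by linarith)]; ring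
  -- termwise integration
  have hint : ∀ j : ℤ, IntegrableOn (fun t => e j * Real.cos (2 * Real.pi * j * t)) (Set.Ioc (-h) h) :=
    fun j => (Continuous.integrableOn_Icc (by fun_prop)).mono_set Set.Ioc_subset_Icc_self
  have hstep1 : (discretizedGaussian p β 0).toReal = ∑' j : ℤ, e j * c j := by
    rw [discretizedGaussian_zero_toReal_eq_integral hβ, intervalIntegral.integral_of_le (by linarith)]
    rw [← integral_tsum_of_summable_integral_norm hint]
    · refine tsum_congr fun j => ?_
      rw [integral_const_mul, ← intervalIntegral.integral_of_le (by linarith)]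
    · refine Summable.of_nonneg_of_le (fun j => integral_nonneg fun t => norm_nonneg _)
        (fun j => ?_) (he.mul_right (2 * h))
      have hle : ∫ t in Set.Ioc (-h) h, ‖e j * Real.cos (2 * Real.pi * j * t)‖
          ≤ ∫ t in Set.Ioc (-h) h, e j := by
        refine integral_mono_of_nonneg (ae_of_all _ fun t => norm_nonneg _)
          (integrableOn_const (by simp [Real.volume_Ioc]) ) (ae_of_all _ fun t => ?_)
        dsimp only
        rw [norm_mul, Real.norm_eq_abs, Real.norm_eq_abs, abs_of_pos (Real.exp_pos _)]
        exact mul_le_of_le_one_right (Real.exp_pos _).le (Real.abs_cos_le_one _)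
      refine hle.trans (le_of_eq ?_)
      rw [setIntegral_const, smul_eq_mul, Real.volume_real_Ioc_of_le (by linarith), mul_comm]
      ring
  -- from `ℤ` to `ℕ`
  have hsum : Summable fun j : ℤ => e j * c j := by
    refine Summable.of_norm_bounded (g := fun j => e j * (2 * h)) (he.mul_right _) fun j => ?_
    rw [norm_mul, Real.norm_eq_abs, Real.norm_eq_abs, abs_of_pos (Real.exp_pos _)]
    exact mul_le_mul_of_nonneg_left (hcabs j) (Real.exp_pos _).le
  have heven : Function.Even fun j : ℤ => e j * c j := by
    intro j
    simp only [hedef, hcdef, Int.cast_neg, even_two, Even.neg_pow]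
    congr 1
    refine intervalIntegral.integral_congr fun t _ => ?_
    simp only [mul_neg, neg_mul, Real.cos_neg]
  rw [hstep1, tsum_int_eq_zero_add_two_mul_tsum_pnat heven hsum, tsum_pnat_eq_tsum_succ
    (f := fun j : ℕ => e j * c j)]
  simp only [hc0]
  congr 1
  · simp [hedef]
  · rw [(summable_zeroMassTerm p hβ).tsum_eq_zero_add, zeroMassTerm_zero, zero_add, nsmul_eq_mul,
      Nat.cast_ofNat]
    congr 1
    refine tsum_congr fun j => ?_
    have hj : ((j + 1 : ℕ) : ℤ) ≠ 0 := by omega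
    rw [hcj _ hj, zeroMassTerm]
    simp [hedef]

/-! ### Grouping the series by residues and the alternating-series bound -/

/-- Regrouping an absolutely convergent series over `ℕ` by residues modulo `p`. [folklore] -/
theorem tsum_nat_eq_sum_fin_tsum {g : ℕ → ℝ} (hg : Summable g) (p : ℕ) [NeZero p] :
    ∑' n, g n = ∑ r : Fin p, ∑' l : ℕ, g (l * p + r) := by
  let e : ℕ ≃ Fin p × ℕ := (Nat.divModEquiv p).trans (Equiv.prodComm _ _)
  have hs : Summable fun x : Fin p × ℕ => g (e.symm x) := (Equiv.summable_iff e.symm).2 hg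
  rw [← Equiv.tsum_eq e.symm g, hs.tsum_prod' (fun r => hs.prod_factor r), tsum_fintype]
  rfl

variable (p)

/-- The alternating terms `a_r(ℓ) = e^{-πβ²(ℓp+r)²}/(ℓp+r)`. [folklore] -/
def altTerm (β : ℝ) (r l : ℕ) : ℝ :=
  Real.exp (-Real.pi * β ^ 2 * ((l * p + r : ℕ) : ℝ) ^ 2) / ((l * p + r : ℕ) : ℝ)

/-- `a_r(ℓ) ≥ 0`. [folklore] -/
theorem altTerm_nonneg (β : ℝ) (r l : ℕ) : 0 ≤ altTerm p β r l := by
  unfold altTerm; positivity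

/-- `a_r` is antitone in `ℓ` (for `r ≥ 1`). [folklore] -/
theorem antitone_altTerm {β : ℝ} (hβ : 0 < β) {r : ℕ} (hr : 1 ≤ r) : Antitone (altTerm p β r) := by
  refine antitone_nat_of_succ_le fun l => ?_
  unfold altTerm
  have h1 : (1 : ℝ) ≤ ((l * p + r : ℕ) : ℝ) := by exact_mod_cast (by omega : 1 ≤ l * p + r)
  have h2 : ((l * p + r : ℕ) : ℝ) ≤ (((l + 1) * p + r : ℕ) : ℝ) := by
    exact_mod_cast (by nlinarith : l * p + r ≤ (l + 1) * p + r)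
  refine div_le_div₀ (Real.exp_pos _).le ?_ (by linarith) h2
  rw [Real.exp_le_exp]
  have : ((l * p + r : ℕ) : ℝ) ^ 2 ≤ (((l + 1) * p + r : ℕ) : ℝ) ^ 2 := by nlinarith
  nlinarith [mul_pos Real.pi_pos (pow_pos hβ 2)]

/-- `a_r(ℓ) ≤ (e^{-πβ²})^ℓ` (for `r ≥ 1`), so `a_r` is summable. [folklore] -/
theorem altTerm_le_geom [NeZero p] {β : ℝ} (hβ : 0 < β) {r : ℕ} (hr : 1 ≤ r) (l : ℕ) :
    altTerm p β r l ≤ Real.exp (-Real.pi * β ^ 2) ^ l := by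
  unfold altTerm
  have h1 : (1 : ℝ) ≤ ((l * p + r : ℕ) : ℝ) := by exact_mod_cast (by omega : 1 ≤ l * p + r)
  have hp1 : 1 ≤ p := Nat.one_le_iff_ne_zero.2 (NeZero.ne p)
  have hl : (l : ℝ) ≤ ((l * p + r : ℕ) : ℝ) := by
    exact_mod_cast (by nlinarith : l ≤ l * p + r)
  calc _ ≤ Real.exp (-Real.pi * β ^ 2 * ((l * p + r : ℕ) : ℝ) ^ 2) := div_le_self (Real.exp_pos _).le h1
    _ ≤ Real.exp (l * (-Real.pi * β ^ 2)) := by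
        rw [Real.exp_le_exp]
        have : (l : ℝ) ≤ ((l * p + r : ℕ) : ℝ) ^ 2 := by nlinarith
        nlinarith [mul_pos Real.pi_pos (pow_pos hβ 2)]
    _ = _ := Real.exp_nat_mul _ _

/-- `a_r` is summable (for `r ≥ 1`). [folklore] -/
theorem summable_altTerm [NeZero p] {β : ℝ} (hβ : 0 < β) {r : ℕ} (hr : 1 ≤ r) :
    Summable (altTerm p β r) := by
  refine Summable.of_nonneg_of_le (altTerm_nonneg p β r) (altTerm_le_geom p hβ hr) ?_
  exact summable_geometric_of_lt_one (Real.exp_pos _).le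
    (Real.exp_lt_one_iff.2 (by nlinarith [Real.pi_pos, pow_pos hβ 2]))

/-- **Leibniz bound**: `∑ (-1)^ℓ a_r(ℓ) ≥ a_r(0) - a_r(1) ≥ 0`. [folklore] -/
theorem sub_le_tsum_alternating_altTerm [NeZero p] {β : ℝ} (hβ : 0 < β) {r : ℕ} (hr : 1 ≤ r) :
    altTerm p β r 0 - altTerm p β r 1 ≤ ∑' l : ℕ, (-1) ^ l * altTerm p β r l := by
  have h := Antitone.alternating_series_le_tendsto
    ((summable_altTerm p hβ hr).tendsto_alternating_series_tsum) (antitone_altTerm p hβ hr) 1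
  simpa [Finset.sum_range_succ] using h

variable {p}

/-- The terms of the zero-mass series in the residue class `r`: they vanish for `r = 0` and are
`(sin(πr/p)/π) (-1)^ℓ a_r(ℓ)` otherwise. [folklore] -/
theorem zeroMassTerm_mul_add [NeZero p] {β : ℝ} (r l : ℕ) :
    zeroMassTerm p β (l * p + r) =
      Real.sin (Real.pi * r / p) / Real.pi * ((-1) ^ l * altTerm p β r l) := by
  have hp : (p : ℝ) ≠ 0 := by exact_mod_cast NeZero.ne p
  rw [zeroMassTerm, altTerm]
  have hsin : Real.sin (Real.pi * ((l * p + r : ℕ) : ℝ) / p) = (-1) ^ l * Real.sin (Real.pi * r / p) := by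
    rw [← Real.sin_add_nat_mul_pi]
    congr 1
    push_cast
    field_simp
    ring
  rw [hsin]
  ring

/-- **The zero-mass series is a finite sum of nonnegative alternating series**:
`∑ⱼ g_j = ∑_{1 ≤ r < p} (sin(πr/p)/π) ∑_ℓ (-1)^ℓ a_r(ℓ)`. [folklore] -/
theorem tsum_zeroMassTerm_eq_sum [NeZero p] {β : ℝ} (hβ : 0 < β) :
    ∑' j, zeroMassTerm p β j =
      ∑ r : Fin p, Real.sin (Real.pi * r / p) / Real.pi * ∑' l : ℕ, (-1) ^ l * altTerm p β r l := by
  rw [tsum_nat_eq_sum_fin_tsum (summable_zeroMassTerm p hβ) p]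
  refine Finset.sum_congr rfl fun r _ => ?_
  rw [← tsum_mul_left]
  exact tsum_congr fun l => zeroMassTerm_mul_add r l

/-- Each residue class contributes a nonnegative amount. [folklore] -/
theorem residue_term_nonneg [NeZero p] {β : ℝ} (hβ : 0 < β) (r : Fin p) :
    0 ≤ Real.sin (Real.pi * r / p) / Real.pi * ∑' l : ℕ, (-1) ^ l * altTerm p β r l := by
  have hp : (0 : ℝ) < p := by exact_mod_cast Nat.pos_of_ne_zero (NeZero.ne p)
  rcases Nat.eq_zero_or_pos (r : ℕ) with hr | hr
  · simp [hr]
  · refine mul_nonneg (div_nonneg (Real.sin_nonneg_of_nonneg_of_le_pi (by positivity) ?_)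
      Real.pi_pos.le) ?_
    · rw [div_le_iff₀ hp]
      have : ((r : ℕ) : ℝ) ≤ p := by exact_mod_cast r.isLt.le
      nlinarith [Real.pi_pos]
    · refine le_trans ?_ (sub_le_tsum_alternating_altTerm p hβ hr)
      exact sub_nonneg.2 (antitone_altTerm p hβ hr (by norm_num))

/-- The class `r = 1` contributes at least `(sin(π/p)/π) · (2/3) e^{-πβ²}` (`p ≥ 2`). [folklore] -/
theorem residue_one_ge [NeZero p] {β : ℝ} (hβ : 0 < β) (hp : 2 ≤ p) :
    Real.sin (Real.pi / p) / Real.pi * (2 / 3 * Real.exp (-Real.pi * β ^ 2)) ≤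
      Real.sin (Real.pi * (1 : ℕ) / p) / Real.pi * ∑' l : ℕ, (-1) ^ l * altTerm p β 1 l := by
  have hp0 : (0 : ℝ) < p := by exact_mod_cast Nat.pos_of_ne_zero (NeZero.ne p)
  rw [Nat.cast_one, mul_one]
  have hsin : 0 ≤ Real.sin (Real.pi / p) / Real.pi := by
    refine div_nonneg (Real.sin_nonneg_of_nonneg_of_le_pi (by positivity) ?_) Real.pi_pos.le
    rw [div_le_iff₀ hp0]
    have : (1 : ℝ) ≤ p := by exact_mod_cast Nat.one_le_iff_ne_zero.2 (NeZero.ne p)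
    nlinarith [Real.pi_pos]
  refine mul_le_mul_of_nonneg_left (le_trans ?_ (sub_le_tsum_alternating_altTerm p hβ le_rfl)) hsin
  have h0 : altTerm p β 1 0 = Real.exp (-Real.pi * β ^ 2) := by simp [altTerm]
  have h1 : altTerm p β 1 1 ≤ Real.exp (-Real.pi * β ^ 2) / 3 := by
    unfold altTerm
    have h3 : (3 : ℝ) ≤ ((1 * p + 1 : ℕ) : ℝ) := by exact_mod_cast (by omega : 3 ≤ 1 * p + 1)
    refine div_le_div₀ (Real.exp_pos _).le ?_ (by norm_num) h3
    rw [Real.exp_le_exp]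
    have : (1 : ℝ) ≤ ((1 * p + 1 : ℕ) : ℝ) ^ 2 := by nlinarith
    nlinarith [mul_pos Real.pi_pos (pow_pos hβ 2)]
  rw [h0]
  linarith

/-! ### The bounds -/

/-- **`Ψ̄_β(0) ≥ 1/p` for every modulus `p ≥ 1` and width `β > 0`** (the discretised Gaussian puts
at least the uniform mass on `0`). [Regev 2009, §1–§2; folklore] [folklore] -/
theorem discretizedGaussian_zero_toReal_ge_inv [NeZero p] {β : ℝ} (hβ : 0 < β) :
    1 / (p : ℝ) ≤ (discretizedGaussian p β 0).toReal := by
  rw [discretizedGaussian_zero_toReal_eq_tsum hβ, tsum_zeroMassTerm_eq_sum hβ]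
  have : 0 ≤ ∑ r : Fin p, Real.sin (Real.pi * r / p) / Real.pi * ∑' l : ℕ, (-1) ^ l * altTerm p β r l :=
    Finset.sum_nonneg fun r _ => residue_term_nonneg hβ r
  linarith

/-- **`Ψ̄_β(0) ≥ 1/p + (4/(3π)) sin(π/p) e^{-πβ²}` for `p ≥ 2`, `β > 0`**: the quantitative
non-uniformity of Regev's discretised Gaussian at `0` (Regev 2009, §1, p. 4: "a value chosen from
`Ψ̄_α` is `0` with probability roughly `1/(αp)`"; here a uniform explicit lower bound).
[cite: Regev2009, §1 p. 4 and §2 (definition of Ψ̄_α)] -/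
theorem discretizedGaussian_zero_toReal_ge [NeZero p] {β : ℝ} (hβ : 0 < β) (hp : 2 ≤ p) :
    1 / (p : ℝ) + 4 / (3 * Real.pi) * Real.sin (Real.pi / p) * Real.exp (-Real.pi * β ^ 2) ≤
      (discretizedGaussian p β 0).toReal := by
  rw [discretizedGaussian_zero_toReal_eq_tsum hβ, tsum_zeroMassTerm_eq_sum hβ]
  have h1 : Real.sin (Real.pi * ((⟨1, hp⟩ : Fin p) : ℕ) / p) / Real.pi *
      ∑' l : ℕ, (-1) ^ l * altTerm p β ((⟨1, hp⟩ : Fin p) : ℕ) l ≤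
      ∑ r : Fin p, Real.sin (Real.pi * r / p) / Real.pi * ∑' l : ℕ, (-1) ^ l * altTerm p β r l :=
    Finset.single_le_sum (fun r _ => residue_term_nonneg hβ r) (Finset.mem_univ _)
  have h2 := residue_one_ge hβ hp
  have : 4 / (3 * Real.pi) * Real.sin (Real.pi / p) * Real.exp (-Real.pi * β ^ 2)
      = 2 * (Real.sin (Real.pi / p) / Real.pi * (2 / 3 * Real.exp (-Real.pi * β ^ 2))) := by
    field_simp; ring
  rw [this]
  linarith

/-- `Ψ̄_β(0) ≥ 1/p` in `ℝ≥0∞`. [folklore] -/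
theorem inv_le_discretizedGaussian_zero [NeZero p] {β : ℝ} (hβ : 0 < β) :
    (p : ℝ≥0∞)⁻¹ ≤ discretizedGaussian p β 0 := by
  have h := discretizedGaussian_zero_toReal_ge_inv (p := p) hβ
  have hne : discretizedGaussian p β 0 ≠ ∞ := PMF.apply_ne_top _ _
  rw [← ENNReal.ofReal_toReal hne]
  have hp : (0 : ℝ) < p := by exact_mod_cast Nat.pos_of_ne_zero (NeZero.ne p)
  calc (p : ℝ≥0∞)⁻¹ = ENNReal.ofReal (1 / p) := by
        rw [one_div, ENNReal.ofReal_inv_of_pos hp, ENNReal.ofReal_natCast]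
    _ ≤ _ := ENNReal.ofReal_le_ofReal h

end Series

/-! ### Subgroups of `ℤ_q` -/

section Subgroups

variable {q : ℕ} [NeZero q]

/-- Every subgroup of `ℤ_q` is `d ℤ_q` for a divisor `d` of `q`. [folklore] -/
theorem exists_eq_zmultiples_natCast (H : AddSubgroup (ZMod q)) :
    ∃ d : ℕ, d ∣ q ∧ H = AddSubgroup.zmultiples ((d : ℕ) : ZMod q) := by
  obtain ⟨⟨g, hgH⟩, hg⟩ := isAddCyclic_iff_exists_zmultiples_eq_top.mp (inferInstance : IsAddCyclic H)
  have hHg : H = AddSubgroup.zmultiples g := by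
    refine le_antisymm (fun x hx => ?_) (AddSubgroup.zmultiples_le_of_mem hgH)
    have hx' : (⟨x, hx⟩ : H) ∈ AddSubgroup.zmultiples (⟨g, hgH⟩ : H) := by rw [hg]; trivial
    obtain ⟨k, hk⟩ := AddSubgroup.mem_zmultiples_iff.1 hx'
    refine AddSubgroup.mem_zmultiples_iff.2 ⟨k, ?_⟩
    have := congrArg Subtype.val hk
    simpa using this
  set d : ℕ := Nat.gcd g.val q with hddef
  refine ⟨d, Nat.gcd_dvd_right _ _, ?_⟩
  rw [hHg]
  refine le_antisymm (AddSubgroup.zmultiples_le_of_mem ?_) (AddSubgroup.zmultiples_le_of_mem ?_)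
  · -- `g ∈ d ℤ_q`
    obtain ⟨k, hk⟩ := Nat.gcd_dvd_left g.val q
    rw [← hddef] at hk
    refine AddSubgroup.mem_zmultiples_iff.2 ⟨k, ?_⟩
    have hg' : (g : ZMod q) = ((g.val : ℕ) : ZMod q) := (ZMod.natCast_zmod_val g).symm
    rw [hg', hk]
    push_cast
    rw [zsmul_eq_mul]
    push_cast
    ring
  · -- `d ∈ ⟨g⟩` by Bézout
    refine AddSubgroup.mem_zmultiples_iff.2 ⟨Nat.gcdA g.val q, ?_⟩
    have hb := Nat.gcd_eq_gcd_ab g.val q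
    have hb' := congrArg (fun z : ℤ => (z : ZMod q)) hb
    simp only [Int.cast_natCast] at hb'
    rw [hb']
    push_cast
    rw [ZMod.natCast_self, zero_mul, add_zero, ZMod.natCast_zmod_val, zsmul_eq_mul, mul_comm]

omit [NeZero q] in
/-- Membership in `d ℤ_q` of an integer residue is divisibility by `d` (`d ∣ q`). [folklore] -/
theorem intCast_mem_zmultiples_natCast_iff {d : ℕ} (hd : d ∣ q) (r : ℤ) :
    ((r : ℤ) : ZMod q) ∈ AddSubgroup.zmultiples ((d : ℕ) : ZMod q) ↔ (d : ℤ) ∣ r := by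
  rw [AddSubgroup.mem_zmultiples_iff]
  constructor
  · rintro ⟨k, hk⟩
    rw [zsmul_eq_mul] at hk
    have h1 : (((k * d - r : ℤ)) : ZMod q) = 0 := by push_cast; rw [hk]; ring
    rw [ZMod.intCast_zmod_eq_zero_iff_dvd] at h1
    have h2 : (d : ℤ) ∣ k * d - r := (Int.natCast_dvd_natCast.2 hd).trans h1
    have h3 : (d : ℤ) ∣ k * d := dvd_mul_left _ _
    simpa using (dvd_sub h3 h2)
  · rintro ⟨k, rfl⟩
    refine ⟨k, ?_⟩
    rw [zsmul_eq_mul]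
    push_cast
    ring

/-- `|d ℤ_q| = q / d` for `d ∣ q`. [folklore] -/
theorem natCard_zmultiples_natCast {d : ℕ} (hd : d ∣ q) :
    Nat.card (AddSubgroup.zmultiples ((d : ℕ) : ZMod q)) = q / d := by
  rw [Nat.card_zmultiples, ZMod.addOrderOf_coe _ (NeZero.ne q), Nat.gcd_eq_right hd]

omit [NeZero q] in
/-- **Scaling**: the preimage of `d ℤ_q` under `x ↦ ⌊q x⌉ mod q` is the preimage of the zero cell
of modulus `d` under `x ↦ (q/d) x`. [folklore] -/
theorem discretize_preimage_zmultiples {d : ℕ} [NeZero d] (hd : d ∣ q) :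
    discretize q ⁻¹' (AddSubgroup.zmultiples ((d : ℕ) : ZMod q) : Set (ZMod q)) =
      (fun x : ℝ => ((q : ℝ) / d) * x) ⁻¹' (discretize d ⁻¹' {0}) := by
  have hd0 : (d : ℝ) ≠ 0 := by exact_mod_cast NeZero.ne d
  ext x
  simp only [Set.mem_preimage, SetLike.mem_coe, Set.mem_singleton_iff, discretize]
  rw [intCast_mem_zmultiples_natCast_iff hd, ← ZMod.intCast_zmod_eq_zero_iff_dvd]
  rw [show (d : ℝ) * ((q : ℝ) / d * x) = q * x by field_simp]

omit [NeZero q] in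
/-- **Scaling for the Gaussian**: `Ψ̄_{q,β}(d ℤ_q) = Ψ̄_{d, βq/d}(0)`. [folklore] -/
theorem gaussianReal_preimage_zmultiples {β : ℝ} (hβ : 0 < β) {d : ℕ} [NeZero d] (hd : d ∣ q) :
    gaussianReal 0 (Real.toNNReal (β ^ 2 / (2 * Real.pi)))
        (discretize q ⁻¹' (AddSubgroup.zmultiples ((d : ℕ) : ZMod q) : Set (ZMod q))) =
      discretizedGaussian d (β * q / d) 0 := by
  have hd0 : (0 : ℝ) < d := by exact_mod_cast Nat.pos_of_ne_zero (NeZero.ne d)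
  rw [discretize_preimage_zmultiples hd, ← Measure.map_apply (measurable_const_mul _)
    ((measurable_discretize d) (measurableSet_singleton _)), gaussianReal_map_const_mul,
    discretizedGaussian_apply, mul_zero]
  congr 2
  apply NNReal.coe_injective
  rw [NNReal.coe_mul, NNReal.coe_mk, Real.coe_toNNReal _ (by positivity),
    Real.coe_toNNReal _ (by positivity)]
  field_simp

/-- **`Ψ̄_β(H) ≥ |H|/q` for every subgroup `H ≤ ℤ_q`** (`β > 0`), in the form: for every finite
set `S` with the same elements as `H`, `#S / q ≤ ∑_{x ∈ S} Ψ̄_β(x)`. Proof: `H = dℤ_q` with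
`|H| = q/d`, and `Ψ̄_{q,β}(dℤ_q) = Ψ̄_{d,βq/d}(0) ≥ 1/d`. [Regev 2009, §1–§2; folklore] [folklore] -/
theorem discretizedGaussian_sum_addSubgroup_ge {β : ℝ} (hβ : 0 < β) (H : AddSubgroup (ZMod q))
    (S : Finset (ZMod q)) (hS : ∀ x, x ∈ S ↔ x ∈ H) :
    (S.card : ℝ≥0∞) / q ≤ ∑ x ∈ S, discretizedGaussian q β x := by
  classical
  obtain ⟨d, hd, rfl⟩ := exists_eq_zmultiples_natCast H
  have hq0 : q ≠ 0 := NeZero.ne q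
  have hdq : d ≠ 0 := by rintro rfl; exact hq0 (zero_dvd_iff.1 hd)
  haveI : NeZero d := ⟨hdq⟩
  -- the sum is the Gaussian mass of the preimage
  have hsum : ∑ x ∈ S, discretizedGaussian q β x =
      gaussianReal 0 (Real.toNNReal (β ^ 2 / (2 * Real.pi)))
        (discretize q ⁻¹' (AddSubgroup.zmultiples ((d : ℕ) : ZMod q) : Set (ZMod q))) := by
    simp_rw [discretizedGaussian_apply]
    rw [sum_measure_preimage_singleton S (fun y _ => (measurable_discretize q) (measurableSet_singleton _))]
    congr 2
    ext x
    simp [hS]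
  -- the cardinality
  have hcard : S.card = q / d := by
    rw [← natCard_zmultiples_natCast hd, Nat.card_eq_fintype_card, Fintype.card_of_subtype S hS]
  have hqd : (q : ℝ≥0∞) = ((q / d : ℕ) : ℝ≥0∞) * d := by exact_mod_cast (Nat.div_mul_cancel hd).symm
  have hle : (S.card : ℝ≥0∞) / q ≤ (d : ℝ≥0∞)⁻¹ := by
    rw [hcard]
    refine ENNReal.div_le_of_le_mul ?_
    rw [hqd, mul_comm ((q / d : ℕ) : ℝ≥0∞), ← mul_assoc,
      ENNReal.inv_mul_cancel (by exact_mod_cast hdq) (ENNReal.natCast_ne_top d), one_mul]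
  refine hle.trans ?_
  rw [hsum, gaussianReal_preimage_zmultiples hβ hd]
  exact inv_le_discretizedGaussian_zero (by positivity)

end Subgroups

end LWE

end Literature.Computability.Cryptography

end
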